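import Summits.ResolutionOfSingularities.ResolutionOfSingularities.Theorems.FrobeniusClosingSteerCore4CompositeRankConcl

/-!
# Steer core, composite rank in EVERY dimension, part 1/2: regular models from resolution of quasi-excellent schemes of dimension `≤ d`

OURS (campaign res-hironaka, rung L, slot W4.1, crux `Steer` stmt-ResolutionOfSingularities-16345, line
`switching_dichotomy` / res-L0-w41-strat-1's `ss-monomial-cycles` §F, stub S0 `CompositeRankSS`; prover seat res-type-028
gen 8; replaces the role of no printed item; NOT a statement of the manuscript under review; AI-produced, weaker than expert
review). `--supports stmt-ResolutionOfSingularities-16345 --as helper`.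

Parts 1/2 + 2/2 (`…CompositeRankBelow.lean`) are the DIMENSION-GENERIC twin («`3 ↦ d`, `4 ↦ d + 1`», same proofs) of the landed
`n = 4` composite-rank discharge `Theorems/FrobeniusClosingSteerCore4CompositeRank.lean` + `…CompositeRankConcl.lean`
(res-L0-w41-idea-1, p493179 / p493665), with the named fact `CossartPiltant2019General` replaced by the WEAKEST hypothesis those
proofs consume, spelled out (no new definition):

  `hQE : ∀ (X : Scheme) [X.IsSeparated] [IsNoetherian X] [IsReduced X], X.IsQuasiExcellent → topologicalKrullDim X ≤ d →
    X.HasResolution`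

("every reduced separated Noetherian quasi-excellent scheme of dimension `≤ d` admits a resolution"; at `d = 3` this is
implied by `CossartPiltant2019General`, whose extra clause — isomorphism over the regular locus — is not used).

This part: `exists_fg_regular_of_qeRes`, `model_regular_of_qeRes`, `residueModel_regular_of_qeRes` — (LU) and regular models
in local dimension `≤ d` (twins of `exists_fg_regular_of_cp2019` / `model_regular_of_cp2019` / `residueModel_regular_of_cp2019`).
No definitions.
-/


noncomputable section

-- single-problem summit: the doubled namespace component `ResolutionOfSingularities` is forced
set_option linter.dupNamespace false

open scoped BigOperators Classical

namespace Summit.ResolutionOfSingularities.ResolutionOfSingularities.Theorems.SteerRankThinness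

section CompositeBelow

open IsLocalRing Algebra
open Literature.AlgebraicGeometry.Resolution
open CategoryTheory AlgebraicGeometry

universe u

variable {k K : Type u} [Field k] [Field K] [Algebra k K]

/-- **(LU) in dimension `≤ d` from resolution of quasi-excellent schemes of dimension `≤ d`** (PROVED; the `3 ↦ d`
twin of `exists_fg_regular_of_cp2019`, same proof: `Spec D` is affine hence separated, excellent hence quasi-excellent,
and the valuative criterion `exists_fg_regular_of_hasResolution` reads (LU) off the resolution): for an excellent
Noetherian domain `D` of dimension `≤ d` with fraction field `L` and a valuation ring `O ⊇ D` of `L`, some finitely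
generated `D`-subalgebra `T ⊆ O` is regular at the centre `𝔪_O ∩ T`. [folklore] -/
theorem exists_fg_regular_of_qeRes {d : ℕ}
    (hQE : ∀ (X : Scheme.{u}) [X.IsSeparated] [IsNoetherian X] [IsReduced X],
      Scheme.IsQuasiExcellent X → topologicalKrullDim X ≤ d → Scheme.HasResolution X)
    {D : Type u} [CommRing D] [IsDomain D] [IsNoetherianRing D] (hexc : IsExcellentRing D)
    (hdim : ringKrullDim D ≤ d) {L : Type u} [Field L] [Algebra D L] [IsFractionRing D L]
    (O : ValuationSubring L) (hDO : ∀ x : D, algebraMap D L x ∈ O) :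
    ∃ (T : Subalgebra D L) (h : T.toSubring ≤ O.toSubring), T.FG ∧
      IsRegularLocalRing (Localization.AtPrime
        (Ideal.comap (Subring.inclusion h) (maximalIdeal O))) := by
  haveI : IsDomain (CommRingCat.of D) := ‹IsDomain D›
  haveI : IsNoetherianRing (CommRingCat.of D) := ‹IsNoetherianRing D›
  have hexcS : Scheme.IsQuasiExcellent (Spec (.of D)) :=
    (Scheme.isExcellent_Spec_of_isExcellentRing D hexc).isQuasiExcellent
  have hdimS : topologicalKrullDim (Spec (.of D)) ≤ d := by
    change topologicalKrullDim (PrimeSpectrum D) ≤ d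
    rw [PrimeSpectrum.topologicalKrullDim_eq_ringKrullDim]
    exact hdim
  exact exists_fg_regular_of_hasResolution O hDO (hQE (Spec (.of D)) hexcS hdimS)

/-- PROVED (`3 ↦ d` twin of `model_regular_of_cp2019`, same proof with
`exists_fg_regular_of_cp2019 hCP ↦ exists_fg_regular_of_qeRes hQE`): **regular models in local dimension `≤ d`** — if
`R ⊆ O'` is a finitely generated `k`-model of `K = Frac R` whose local ring at the centre `P' = 𝔪_{O'} ∩ R` is excellent
of dimension `≤ d`, some finitely generated `A₁ ⊇ R` inside `O'` is regular at the centre of `O'` (resolve `Spec R_{P'}`,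
read off `T = R_{P'}[g] ⊆ O'`, take `A₁ = R[g]`). [cite: NovacoskiSpivakovsky2014, Lemma 2.5 (1)] -/
theorem model_regular_of_qeRes {d : ℕ}
    (hQE : ∀ (X : Scheme.{u}) [X.IsSeparated] [IsNoetherian X] [IsReduced X],
      Scheme.IsQuasiExcellent X → topologicalKrullDim X ≤ d → Scheme.HasResolution X)
    (O' : ValuationSubring K) (R : Subalgebra k K) (hRfg : R.FG) [IsNoetherianRing R]
    [IsFractionRing R K] (hRO : R.toSubring ≤ O'.toSubring)
    (P' : Ideal R) [P'.IsPrime] (hP' : ∀ z : R, z ∈ P' ↔ O'.valuation (z : K) < 1)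
    (hexc : IsExcellentRing (Localization.AtPrime P'))
    (hdim : ringKrullDim (Localization.AtPrime P') ≤ d) :
    ∃ (A₁ : Subalgebra k K) (hA₁ : A₁.toSubring ≤ O'.toSubring), R ≤ A₁ ∧ A₁.FG ∧
      IsRegularLocalRing
        (Localization.AtPrime ((maximalIdeal O').comap (Subring.inclusion hA₁))) := by
  classical
  -- the local ring `D = R_{P'}` realised inside `K`
  let D : Subalgebra R K :=
    Localization.subalgebra.ofField K P'.primeCompl P'.primeCompl_le_nonZeroDivisors
  haveI : IsLocalization.AtPrime D P' :=
    Localization.subalgebra.isLocalization_ofField K P'.primeCompl P'.primeCompl_le_nonZeroDivisors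
  let e : Localization.AtPrime P' ≃ₐ[R] D :=
    IsLocalization.algEquiv P'.primeCompl (Localization.AtPrime P') D
  haveI : IsNoetherianRing D := isNoetherianRing_of_ringEquiv _ e.toRingEquiv
  have hexcD : IsExcellentRing D := IsExcellentRing.of_ringEquiv e.toRingEquiv hexc
  have hdimD : ringKrullDim D ≤ d := by
    rw [← ringKrullDim_eq_of_ringEquiv e.toRingEquiv]; exact hdim
  haveI : IsFractionRing D K :=
    IsFractionRing.isFractionRing_of_isDomain_of_isLocalization P'.primeCompl D K
  have hmemD : ∀ x : K, x ∈ D ↔ ∃ a : R, ∃ s : R, s ∉ P' ∧ x = (a : K) * ((s : K))⁻¹ := by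
    intro x
    change (∃ (a s : R) (_ : s ∈ P'.primeCompl),
      x = algebraMap R K a * (algebraMap R K s)⁻¹) ↔ _
    constructor
    · rintro ⟨a, s, hs, rfl⟩; exact ⟨a, s, hs, rfl⟩
    · rintro ⟨a, s, hs, rfl⟩; exact ⟨a, s, hs, rfl⟩
  have hunit : ∀ s : R, s ∉ P' → O'.valuation (s : K) = 1 := fun s hs => by
    have hle : O'.valuation (s : K) ≤ 1 := (O'.valuation_le_one_iff _).mpr (hRO s.2)
    exact le_antisymm hle (not_lt.mp fun hlt => hs ((hP' s).mpr hlt))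
  have hDO : ∀ x : D, algebraMap D K x ∈ O' := by
    intro x
    obtain ⟨a, s, hs, hd⟩ := (hmemD x).mp x.2
    change (x : K) ∈ O'
    rw [hd]
    refine mul_mem (hRO a.2) ?_
    rw [← O'.valuation_le_one_iff, map_inv₀, hunit s hs, inv_one]
  -- a regular finitely generated model over `D`
  obtain ⟨T, hT, hTfg, hTreg⟩ := exists_fg_regular_of_qeRes hQE hexcD hdimD O' hDO
  obtain ⟨g, hg⟩ := hTfg
  -- the model `A₁ = R[g]`
  have hRT : ∀ z : K, z ∈ R → z ∈ T := fun z hz => by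
    have hzD : z ∈ D := (hmemD z).mpr ⟨⟨z, hz⟩, 1, fun h1 => by
      have := (hP' 1).mp h1
      simp at this, by simp⟩
    exact T.algebraMap_mem (⟨z, hzD⟩ : D)
  have hk : ∀ c : k, algebraMap k K c ∈ T := fun c => hRT _ (R.algebraMap_mem c)
  let Tk : Subalgebra k K := { T.toSubring with algebraMap_mem' := hk }
  have hTk : Tk.toSubring ≤ O'.toSubring := fun z hz => hT hz
  let A₁ : Subalgebra k K := R ⊔ Algebra.adjoin k (g : Set K)
  have hgT : ∀ z ∈ (g : Set K), z ∈ T := fun z hz => by rw [← hg]; exact Algebra.subset_adjoin hz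
  have hA₁Tk : A₁ ≤ Tk := sup_le (fun z hz => hRT z hz) (Algebra.adjoin_le fun z hz => hgT z hz)
  have hA₁O : A₁.toSubring ≤ O'.toSubring := fun z hz => hT (hA₁Tk hz)
  have hRA₁ : R ≤ A₁ := le_sup_left
  refine ⟨A₁, hA₁O, hRA₁, hRfg.sup ⟨g, rfl⟩, ?_⟩
  haveI : IsFractionRing R.toSubring K := ‹IsFractionRing R K›
  haveI : IsFractionRing A₁.toSubring K := isFractionRing_subalgebra_of_le R A₁ hRA₁
  haveI : IsFractionRing Tk.toSubring K :=
    isFractionRing_subalgebra_of_le R Tk (hRA₁.trans hA₁Tk)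
  -- `T ⊆ L(A₁)`: `D ⊆ L(R) ⊆ L(A₁)` and `g ⊆ A₁`
  have h1 : (Tk : Set K) ⊆ (Localization.subalgebra.ofField K
      ((maximalIdeal O').comap (Subring.inclusion hA₁O)).primeCompl
      (Ideal.primeCompl_le_nonZeroDivisors _)) := by
    have hD : (D : Set K) ⊆ (Localization.subalgebra.ofField K
        ((maximalIdeal O').comap (Subring.inclusion hA₁O)).primeCompl
        (Ideal.primeCompl_le_nonZeroDivisors _)) := by
      intro z hz
      obtain ⟨a, s, hs, rfl⟩ := (hmemD z).mp hz
      rw [SetLike.mem_coe, mem_centreLocalization_iff]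
      exact ⟨a, hRA₁ a.2, s, hRA₁ s.2, hunit s hs, rfl⟩
    have hTcl : T.toSubring = Subring.closure (Set.range (algebraMap D K) ∪ (g : Set K)) := by
      rw [← hg]; exact Algebra.adjoin_eq_ring_closure _
    intro z hz
    have hz' : z ∈ T.toSubring := hz
    rw [hTcl] at hz'
    have hsub : Set.range (algebraMap D K) ∪ (g : Set K) ⊆ ((Localization.subalgebra.ofField K
        ((maximalIdeal O').comap (Subring.inclusion hA₁O)).primeCompl
        (Ideal.primeCompl_le_nonZeroDivisors _)).toSubring : Set K) := by
      rintro w (⟨x, rfl⟩ | hw)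
      · exact hD x.2
      · exact le_centreLocalization O' A₁ hA₁O
          ((le_sup_right : Algebra.adjoin k (g : Set K) ≤ A₁) (Algebra.subset_adjoin hw))
    exact Subring.closure_le.mpr hsub hz'
  have h2 : (A₁ : Set K) ⊆ (Localization.subalgebra.ofField K
      ((maximalIdeal O').comap (Subring.inclusion hTk)).primeCompl
      (Ideal.primeCompl_le_nonZeroDivisors _)) :=
    fun z hz => le_centreLocalization O' Tk hTk (hA₁Tk hz)
  have heq : ((Localization.subalgebra.ofField K
      ((maximalIdeal O').comap (Subring.inclusion hA₁O)).primeCompl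
      (Ideal.primeCompl_le_nonZeroDivisors _)) : Set K)
      = (Localization.subalgebra.ofField K
      ((maximalIdeal O').comap (Subring.inclusion hTk)).primeCompl
      (Ideal.primeCompl_le_nonZeroDivisors _)) :=
    le_antisymm (centreLocalization_le O' A₁ Tk hA₁O hTk h2)
      (centreLocalization_le O' Tk A₁ hTk hA₁O h1)
  exact isRegularLocalRing_of_centreLocalization_eq O' A₁ Tk hA₁O hTk heq hTreg

/-- PROVED (`3 ↦ d` twin of `residueModel_regular_of_cp2019`, same proof ending in `model_regular_of_qeRes`):
**local uniformization of `ν₂` above the residue model** — the input `h₂` of `novacoskiSpivakovsky2014_cor217`: with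
`A ⊆ O ≤ O₁` a finitely generated `k`-model, `Q ⊇ P` the two centres, `φ : A → κ ⊆ κ(O₁)` the residue map
(`φ(A) ≅ A/P`) and `ht (Q/P) ≤ d`, a regular finitely generated model `B ⊇ φ(A)` of `ν₂` on `κ = Frac φ(A)` exists,
given resolution of quasi-excellent schemes of dimension `≤ d`. [cite: NovacoskiSpivakovsky2014, Cor. 2.17] -/
theorem residueModel_regular_of_qeRes {d : ℕ}
    (hQE : ∀ (X : Scheme.{u}) [X.IsSeparated] [IsNoetherian X] [IsReduced X],
      Scheme.IsQuasiExcellent X → topologicalKrullDim X ≤ d → Scheme.HasResolution X)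
    (O O₁ : ValuationSubring K) (hO : O ≤ O₁) (A : Subalgebra k K)
    (hA : A.toSubring ≤ O.toSubring) (hAfg : A.FG) (Q P : Ideal A) [Q.IsPrime] [P.IsPrime]
    (hQ : ∀ z : A, z ∈ Q ↔ O.valuation (z : K) < 1)
    (hP : ∀ z : A, z ∈ P ↔ O₁.valuation (z : K) < 1) (hPQ : P ≤ Q)
    (hdimQP : (Q.map (Ideal.Quotient.mk P)).height ≤ d)
    (κ : Type u) [Field κ] [Algebra k κ] (ι : κ →+* ResidueField O₁) (φ : A →ₐ[k] κ)
    (hφ : ∀ a : A, ι (φ a) = residue O₁ ⟨(a : K), (hA.trans hO) a.2⟩)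
    (hfr : IsFractionRing φ.range κ) :
    ∃ (B : Subalgebra k κ)
      (hB : B.toSubring ≤ ((residueValuationSubring O O₁ hO).comap ι).toSubring),
      φ.range ≤ B ∧ B.FG ∧
      IsRegularLocalRing (Localization.AtPrime
        ((maximalIdeal ((residueValuationSubring O O₁ hO).comap ι)).comap
          (Subring.inclusion hB))) := by
  classical
  have hS : IsExcellentRing k := isExcellentRing_of_field k
  let O₂ := residueValuationSubring O O₁ hO
  let O₂' := O₂.comap ι
  have hO₂' : ∀ y : κ, O₂'.valuation y < 1 ↔ O₂.valuation (ι y) < 1 := fun y =>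
    valuation_comap_lt_one_iff O₂ ι y
  let B₀ : Subalgebra k κ := φ.range
  have hB₀fg : B₀.FG := by
    have h := ((Subalgebra.fg_top A).mpr hAfg).map φ
    rwa [Algebra.map_top] at h
  haveI : IsNoetherianRing B₀ := isNoetherianRing_of_fg hB₀fg
  haveI : Algebra.FiniteType k B₀ := (Subalgebra.fg_iff_finiteType _).mp hB₀fg
  haveI : IsFractionRing B₀ κ := hfr
  have hB₀O : B₀.toSubring ≤ O₂'.toSubring := by
    intro z hz
    obtain ⟨a, rfl⟩ := (AlgHom.mem_range φ).mp (show z ∈ φ.range from hz)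
    change φ a ∈ O₂.comap ι
    rw [ValuationSubring.mem_comap, hφ]
    exact (residue_mem_residueValuationSubring_iff O O₁ hO _).mpr (hA a.2)
  let 𝔮 : Ideal B₀ := (maximalIdeal O₂').comap (Subring.inclusion hB₀O)
  haveI : 𝔮.IsPrime := Ideal.IsPrime.comap _
  have h𝔮 : ∀ z : B₀, z ∈ 𝔮 ↔ O₂'.valuation (z : κ) < 1 := fun z => by
    rw [Ideal.mem_comap, ValuationSubring.valuation_lt_one_iff]; rfl
  have hexc𝔮 : IsExcellentRing (Localization.AtPrime 𝔮) := isExcellentRing_localization_atPrime hS 𝔮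
  -- `φ(A) ≅ A / P`, carrying the centre of `ν₂` to `Q / P`
  let ψ : A →ₐ[k] B₀ := φ.rangeRestrict
  have hψ : Function.Surjective ψ := AlgHom.rangeRestrict_surjective φ
  have hψval : ∀ a : A, ((ψ a : B₀) : κ) = φ a := fun a => rfl
  have hker : RingHom.ker ψ.toRingHom = P := by
    ext a
    rw [RingHom.mem_ker, hP]
    change ψ a = 0 ↔ _
    rw [Subtype.ext_iff, hψval, ZeroMemClass.coe_zero, ← map_eq_zero_iff ι ι.injective, hφ,
      residue_eq_zero_iff, ValuationSubring.valuation_lt_one_iff]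
  have hψ' : Function.Surjective ψ.toRingHom := hψ
  let e : (A ⧸ P) ≃+* B₀ :=
    (Ideal.quotEquivOfEq hker.symm).trans (RingHom.quotientKerEquivOfSurjective hψ')
  have he : ∀ a : A, e (Ideal.Quotient.mk P a) = ψ a := fun a => by
    change (RingHom.quotientKerEquivOfSurjective hψ')
      (Ideal.quotEquivOfEq hker.symm (Ideal.Quotient.mk P a)) = ψ a
    rw [Ideal.quotEquivOfEq_mk, RingHom.quotientKerEquivOfSurjective_apply_mk]
    rfl
  haveI hQ' : (Q.map (Ideal.Quotient.mk P)).IsPrime :=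
    Ideal.map_isPrime_of_surjective Ideal.Quotient.mk_surjective (by rwa [Ideal.mk_ker])
  have hcomap : 𝔮.comap e = Q.map (Ideal.Quotient.mk P) := by
    ext z
    obtain ⟨a, rfl⟩ := Ideal.Quotient.mk_surjective z
    rw [Ideal.mem_quotient_iff_mem hPQ, Ideal.mem_comap, hQ]
    rw [he, h𝔮, hψval, hO₂', hφ, ← valuation_lt_one_iff_residue O O₁ hO (a : K) (hA a.2)]
  have hheight : 𝔮.height = (Q.map (Ideal.Quotient.mk P)).height := by
    rw [← hcomap]; exact (RingEquiv.height_comap e 𝔮).symm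
  have hdim𝔮 : ringKrullDim (Localization.AtPrime 𝔮) ≤ d := by
    rw [IsLocalization.AtPrime.ringKrullDim_eq_height 𝔮 (Localization.AtPrime 𝔮), hheight]
    exact WithBot.coe_le_coe.mpr hdimQP
  exact model_regular_of_qeRes hQE O₂' B₀ hB₀fg hB₀O 𝔮 h𝔮 hexc𝔮 hdim𝔮

end CompositeBelow

end Summit.ResolutionOfSingularities.ResolutionOfSingularities.Theorems.SteerRankThinness

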